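import Literature.AlgebraicGeometry.Frobenioids.FiberProducts
import HarnessLib

/-!
# Frobenioids I, Proposition 1.6 (v), clause «metrically trivial», direction `C ⇒ C′` — the printed
# clause as a named statement (FALSE AS PRINTED; abc-iut finding F-t8g2-1, FLAG #19)

Mochizuki, *The geometry of Frobenioids I: the general theory*, Kyushu J. Math. **62** (2008)
293–400, §1, Proposition 1.6 (v), kurims text p. 28 [cite: MochizukiFrdI2008, Prop. 1.6(v) p.28]:

> "(v) A object of `C′` is Frobenius-trivial (respectively, quasi-Frobenius-trivial;
> sub-quasi-Frobenius-trivial; metrically trivial; base-trivial; perfect; group-like; unit-trivial;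
> Frobenius-normalized; isotropic; Frobenius-isotropic) if and only if it projects to such an object
> of `C`."

Here `C′ := C ×_D D′` for a Frobenioid `C → F_Φ` over `D` and a functor `D′ → D` between connected,
totally epimorphic categories mapping FSM-morphisms to FSM-morphisms (hypotheses of Prop. 1.6, p. 27);
`C′`, its pre-Frobenioid structure and the other clauses are abc-iut-found's `FiberProducts*.lean`,
where the clause «metrically trivial», direction `C ⇒ C′`, was deliberately left untyped
(`FiberProductsMorphisms.lean`, module docstring ll. 38–42: "the evident lifting argument needs an
isomorphism of the `C`-component with PRESCRIBED projection to `D`").  This file only NAMES that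
printed direction as a closed statement so that its refutation can be recorded against it (RULING P1 of
the abc-iut cell): it is FALSE AS PRINTED — kernel witness `TwoLevel.not_prop16vMetricallyTrivialIf`
(`MetricallyTrivialFiberProductCounterexample.lean`, staged in the cell at
staging/L1/L1-t8/frd16/, combined check sha c40485dc38a7; a two-object Frobenioid over `B(ℤ/2)` with a
metrically trivial, non-`Aut`-ample object, base-changed along `pt → B(ℤ/2)`).  Consumers must NOT
bind it as a hypothesis.  The sibling clause «base-trivial» (same direction) is TRUE:
`PreFrobenioid.isBaseTrivial_fiberProduct_of_fst` (`FiberProductsBaseTrivial.lean`).  The author's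
*Comments* on [FrdI] (Jan 2024) do not touch Prop. 1.6.  Nothing here bears on [IUTchIII] Cor. 3.12.
-/

namespace Literature.AlgebraicGeometry.Frobenioids

open CategoryTheory Opposite

namespace PreFrobenioid

/-- FALSE AS PRINTED (abc-iut finding F-t8g2-1 / FLAG #19; refuted by
`TwoLevel.not_prop16vMetricallyTrivialIf`): **Prop. 1.6 (v), «metrically trivial», direction
`C ⇒ C′`** as a closed statement (universe `0`) — for every Frobenioid `C → F_Φ` over `D`, every
functor `G : D′ → D` from a connected, totally epimorphic `D′` mapping FSM-morphisms to FSM-morphisms,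
and every object `A′` of `C′ = C ×_D D′`: if `A′` projects to a metrically trivial object of `C`,
then `A′` is metrically trivial in `C′`. Do NOT use as a hypothesis. [cite: MochizukiFrdI2008, Prop. 1.6(v) p.28] -/
def Prop16vMetricallyTrivialIf : Prop :=
  ∀ {D : Type} [Category.{0} D] {D' : Type} [Category.{0} D'] {Φ : Dᵒᵖ ⥤ CommMonCat.{0}}
    {C : Type} [Category.{0} C] (F : C ⥤ ElemFrobenioid Φ) (G : D' ⥤ D),
    IsFrobenioid F → IsGraphConnected D' → IsTotallyEpimorphic D' →
    (∀ {a b : D'} (f : a ⟶ b), IsFSM f → IsFSM (G.map f)) →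
    ∀ A' : FiberProduct F G, IsMetricallyTrivial F A'.fst → IsMetricallyTrivial (fiberProductFunctor F G) A'

end PreFrobenioid

end Literature.AlgebraicGeometry.Frobenioids
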